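import Summits.Ventures.Crystal3D.Theorems.StickyWulffConstantNoReconstructionGainCertificate
import HarnessLib

/-!
# Peeling: plug-relative 6-degeneracy gives a transport certificate, and the certificate gives the atom

HONEST FRAMING. Part of the venture `Summits/Ventures/Crystal3D` (cell `crystal3d-full`), helper
`--supports` the crux `NoReconstructionGain` (stmt-Ventures-19144, route
`route-Ventures-StickyWulffConstant`), line `adhesion`; continues
`…NoReconstructionGainCertificate` (the (T2) potential certificate and its telescoping
reduction).  Landed here, def-free and in the registered closed forms typed by planner cf-p2
(R26, `AdhesionOfPotential.lean`):

* `noGainPotential_of_le_six` — the PEELING STEP: a film ball with at most six partners in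
  `P ∪ S`, placed below every film ball outside `S`, satisfies (T2);
* `exists_potential_of_sixDegenerate` — if every nonempty sub-film `S ⊆ T` has a ball with `≤ 6`
  partners in `P ∪ S` (plug-relative 6-degeneracy), an integer potential satisfying (T2) on all of
  `T` exists (induction on the reverse peeling order: the peeled ball goes on top of the rest, the
  outside is lifted above it);
* `potentialCertificateExists_of_sixDegenerate` — the quantified form
  `SixDegenerateFilms → PotentialCertificateExists` (both unfolded; stub registered by name);
* `adhesion_of_certificate` — `PotentialCertificateExists →` the registered atom `stub_adhesion`
  (all normals, linear rim defect `6 C ρ`; stub registered by name).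

So the R26 line reads, in the kernel: plug-relative 6-degeneracy off a rim of `≤ C ρ` balls ⇒
certificate ⇒ `stub_adhesion` ⇒ (with `stub_sampleDeficit`, landed) the crux.  Census R26 (kit
j272189, HOME/cf-p2/jobs/r26): all 8 037 zoo films are plug-relatively 6-degenerate.

WHAT THIS IS NOT: 6-degeneracy or a certificate for any class of films (the open existence part —
as typed, `SixDegenerateFilms` contains «every finite unit packing far from the plug has a ball
with ≤ 6 contacts»); rung F-C1 not moved.
-/

noncomputable section

namespace Summit.Ventures.Crystal3D.Theorems

open Summit.Ventures.Crystal3D Finset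
open Literature.MathematicalPhysics.StatisticalMechanics (orderedContacts contactDeficiency)

/-! ### Peeling: plug-relative 6-degeneracy gives a certificate -/

/-- **One peeling step.**  Let `S ⊆ X \ P` and let `q` have at most six partners in `P ∪ S`.
If `Φ` puts `q` strictly below every film partner outside `S`, then (T2) holds at `q`:
`#below + #level + #plug ≤ #{partners in P ∪ S} ≤ 6`, so `2·#below + 2·#plug + #level ≤ 12`
(no hypothesis on the partners inside `S` is needed). -/
theorem noGainPotential_of_le_six (X P S : Finset (EuclideanSpace ℝ (Fin 3))) (hPX : P ⊆ X)
    (hSX : S ⊆ X \ P) (Φ : EuclideanSpace ℝ (Fin 3) → ℤ) (q : EuclideanSpace ℝ (Fin 3))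
    (hdeg : ((P ∪ S).filter fun x => dist q x = 1).card ≤ 6)
    (habove : ∀ x ∈ (X \ P) \ S, dist q x = 1 → Φ q < Φ x) :
    (((X \ P).filter fun x => dist q x = 1 ∧ Φ x < Φ q).card : ℤ)
        + ((P.filter fun p => dist q p = 1).card : ℤ)
      ≤ (12 - ((X.filter fun x => dist q x = 1).card : ℤ))
        + (((X \ P).filter fun x => dist q x = 1 ∧ Φ q < Φ x).card : ℤ) := by
  classical
  rw [noGainPotential_iff X P hPX Φ q]
  -- below ∪ level ⊆ partners in S
  have hPS : Disjoint P S := (disjoint_sdiff (s := P) (t := X)).mono_right hSX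
  have hunion : ((P ∪ S).filter fun x => dist q x = 1).card =
      (P.filter fun p => dist q p = 1).card + (S.filter fun x => dist q x = 1).card := by
    rw [filter_union, card_union_of_disjoint (disjoint_filter_filter hPS)]
  have hbl : ((X \ P).filter fun x => dist q x = 1 ∧ Φ x < Φ q).card +
      ((X \ P).filter fun x => dist q x = 1 ∧ Φ x = Φ q).card ≤
      (S.filter fun x => dist q x = 1).card := by
    rw [← card_union_of_disjoint]
    · refine card_le_card fun x hx => ?_
      rw [mem_union, mem_filter, mem_filter] at hx
      rw [mem_filter]
      have hxQ : x ∈ X \ P := by rcases hx with h | h <;> exact h.1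
      have hd : dist q x = 1 := by rcases hx with h | h <;> exact h.2.1
      have hle : Φ x ≤ Φ q := by rcases hx with h | h; exacts [h.2.2.le, h.2.2.le]
      by_contra hxS
      have hxS' : x ∉ S := fun h => hxS ⟨h, hd⟩
      exact absurd (habove x (mem_sdiff.2 ⟨hxQ, hxS'⟩) hd) (not_lt.2 hle)
    · exact disjoint_filter.2 fun x _ h1 h2 => by rw [h2.2] at h1; exact lt_irrefl _ h1.2
  zify at hunion hbl hdeg
  linarith

/-- **Peeling ⇒ certificate** (finite core).  If every nonempty `S ⊆ T` (`T ⊆ X \ P`) contains a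
ball with at most six partners in `P ∪ S` (plug-relative 6-degeneracy of `T`), then some integer
potential satisfies (T2) at every ball of `T` (relative to the whole packing `X`).  Proof: induction
on `#S` for the stronger statement "… and `S` lies strictly below `(X \ P) \ S`"; the peeled ball
goes on top of the rest of `S`, the outside is lifted above it by a `max`. -/
theorem exists_potential_of_sixDegenerate (X P T : Finset (EuclideanSpace ℝ (Fin 3))) (hPX : P ⊆ X)
    (hT : T ⊆ X \ P)
    (hdeg : ∀ S ⊆ T, S.Nonempty → ∃ q ∈ S, ((P ∪ S).filter fun x => dist q x = 1).card ≤ 6) :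
    ∃ Φ : EuclideanSpace ℝ (Fin 3) → ℤ, ∀ q ∈ T,
      (((X \ P).filter fun x => dist q x = 1 ∧ Φ x < Φ q).card : ℤ)
          + ((P.filter fun p => dist q p = 1).card : ℤ)
        ≤ (12 - ((X.filter fun x => dist q x = 1).card : ℤ))
          + (((X \ P).filter fun x => dist q x = 1 ∧ Φ q < Φ x).card : ℤ) := by
  classical
  -- the strengthened claim, by induction on the cardinality of `S ⊆ T`
  suffices claim : ∀ n : ℕ, ∀ S ⊆ T, S.card = n → ∃ Φ : EuclideanSpace ℝ (Fin 3) → ℤ,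
      (∀ q ∈ S, (((X \ P).filter fun x => dist q x = 1 ∧ Φ x < Φ q).card : ℤ)
          + ((P.filter fun p => dist q p = 1).card : ℤ)
        ≤ (12 - ((X.filter fun x => dist q x = 1).card : ℤ))
          + (((X \ P).filter fun x => dist q x = 1 ∧ Φ q < Φ x).card : ℤ)) ∧
      (∀ q ∈ S, ∀ x ∈ (X \ P) \ S, Φ q < Φ x) by
    obtain ⟨Φ, hΦ, -⟩ := claim T.card T le_rfl rfl
    exact ⟨Φ, hΦ⟩
  intro n
  induction n with
  | zero =>
    intro S _ hS0
    refine ⟨fun _ => 0, ?_, ?_⟩ <;> simp [card_eq_zero.1 hS0]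
  | succ n ih =>
    intro S hST hSn
    have hSne : S.Nonempty := by rw [← card_pos, hSn]; exact Nat.succ_pos n
    obtain ⟨q₀, hq₀S, hq₀deg⟩ := hdeg S hST hSne
    set S' := S.erase q₀ with hS'
    have hS'T : S' ⊆ T := (erase_subset _ _).trans hST
    have hS'n : S'.card = n := by rw [card_erase_of_mem hq₀S, hSn]; rfl
    obtain ⟨Φ', hT2', hbelow'⟩ := ih S' hS'T hS'n
    have hSX : S ⊆ X \ P := hST.trans hT
    -- the new potential: `S` unchanged, the outside lifted above `q₀`
    let Φ : EuclideanSpace ℝ (Fin 3) → ℤ := fun x => if x ∈ S then Φ' x else max (Φ' x) (Φ' q₀ + 1)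
    have hΦS : ∀ x ∈ S, Φ x = Φ' x := fun x hx => by simp [Φ, hx]
    have hΦout : ∀ x, x ∉ S → Φ x = max (Φ' x) (Φ' q₀ + 1) := fun x hx => by simp [Φ, hx]
    -- (i) `S` lies strictly below the outside
    have hout : ∀ q ∈ S, ∀ x ∈ (X \ P) \ S, Φ q < Φ x := by
      intro q hq x hx
      have hxS : x ∉ S := (mem_sdiff.1 hx).2
      rw [hΦS q hq, hΦout x hxS]
      by_cases hqq : q = q₀
      · rw [hqq]; exact lt_of_lt_of_le (lt_add_one _) (le_max_right _ _)
      · have hq' : q ∈ S' := mem_erase.2 ⟨hqq, hq⟩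
        have hx' : x ∈ (X \ P) \ S' :=
          mem_sdiff.2 ⟨(mem_sdiff.1 hx).1, fun h => hxS (mem_of_mem_erase h)⟩
        exact lt_of_lt_of_le (hbelow' q hq' x hx') (le_max_left _ _)
    refine ⟨Φ, fun q hq => ?_, hout⟩
    by_cases hqq : q = q₀
    · -- (ii) the peeled ball: on top of `S`, below the outside
      subst hqq
      exact noGainPotential_of_le_six X P S hPX hSX Φ q hq₀deg (fun x hx _ => hout q hq x hx)
    · -- (iii) the other balls of `S`: below and level sets are unchanged
      have hq' : q ∈ S' := mem_erase.2 ⟨hqq, hq⟩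
      have hsame : ∀ x ∈ X \ P, (Φ x < Φ q ↔ Φ' x < Φ' q) ∧ (Φ x = Φ q ↔ Φ' x = Φ' q) := by
        intro x hx
        by_cases hxS : x ∈ S
        · rw [hΦS x hxS, hΦS q hq]; exact ⟨Iff.rfl, Iff.rfl⟩
        · have hlt' : Φ' q < Φ' x :=
            hbelow' q hq' x (mem_sdiff.2 ⟨hx, fun h => hxS (mem_of_mem_erase h)⟩)
          have hlt : Φ q < Φ x := hout q hq x (mem_sdiff.2 ⟨hx, hxS⟩)
          exact ⟨⟨fun h => absurd h (not_lt.2 hlt.le), fun h => absurd h (not_lt.2 hlt'.le)⟩,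
            ⟨fun h => absurd h.symm hlt.ne, fun h => absurd h.symm hlt'.ne⟩⟩
      have hb : ((X \ P).filter fun x => dist q x = 1 ∧ Φ x < Φ q) =
          ((X \ P).filter fun x => dist q x = 1 ∧ Φ' x < Φ' q) :=
        filter_congr fun x hx => by rw [(hsame x hx).1]
      have hl : ((X \ P).filter fun x => dist q x = 1 ∧ Φ x = Φ q) =
          ((X \ P).filter fun x => dist q x = 1 ∧ Φ' x = Φ' q) :=
        filter_congr fun x hx => by rw [(hsame x hx).2]
      rw [noGainPotential_iff X P hPX Φ q, hb, hl]
      rw [← noGainPotential_iff X P hPX Φ' q]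
      exact hT2' q hq'

open scoped InnerProductSpace in
open Literature.MathematicalPhysics.StatisticalMechanics (fccStacking) in
/-- **`potentialCertificateExists_of_sixDegenerate`** (R26 target typed by planner cf-p2, in the
registered closed form; `SixDegenerateFilms → PotentialCertificateExists` with both unfolded):
if around every `ν`-plug every sub-film off a rim set of `≤ C ρ` balls is plug-relatively
6-degenerate, then an integer potential satisfying (T2) off that rim set exists (same `R`, `C`). -/
theorem potentialCertificateExists_of_sixDegenerate :
    (∃ R C : ℝ, 1 ≤ R ∧ ∀ ν : EuclideanSpace ℝ (Fin 3), ‖ν‖ = 1 → ∀ ρ : ℝ, R ≤ ρ →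
      ∀ X P : Finset (EuclideanSpace ℝ (Fin 3)),
      (∀ p ∈ X, ∀ q ∈ X, p ≠ q → 1 ≤ dist p q) → P ⊆ X →
      (∀ p, p ∈ P ↔ (p ∈ fccStacking 1 (Real.sqrt (2 / 3)) ∧ -(2 * R) ≤ ⟪p, ν⟫_ℝ ∧
        ⟪p, ν⟫_ℝ ≤ -R ∧ ‖p‖ ^ 2 - ⟪p, ν⟫_ℝ ^ 2 ≤ ρ ^ 2)) →
      ∃ E : Finset (EuclideanSpace ℝ (Fin 3)), E ⊆ X \ P ∧ (E.card : ℝ) ≤ C * ρ ∧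
        ∀ S ⊆ (X \ P) \ E, (S.Nonempty → ∃ q ∈ S, ((P ∪ S).filter fun x => dist q x = 1).card ≤ 6)) →
    (∃ R C : ℝ, 1 ≤ R ∧ ∀ ν : EuclideanSpace ℝ (Fin 3), ‖ν‖ = 1 → ∀ ρ : ℝ, R ≤ ρ →
      ∀ X P : Finset (EuclideanSpace ℝ (Fin 3)),
      (∀ p ∈ X, ∀ q ∈ X, p ≠ q → 1 ≤ dist p q) → P ⊆ X →
      (∀ p, p ∈ P ↔ (p ∈ fccStacking 1 (Real.sqrt (2 / 3)) ∧ -(2 * R) ≤ ⟪p, ν⟫_ℝ ∧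
        ⟪p, ν⟫_ℝ ≤ -R ∧ ‖p‖ ^ 2 - ⟪p, ν⟫_ℝ ^ 2 ≤ ρ ^ 2)) →
      ∃ (Φ : EuclideanSpace ℝ (Fin 3) → ℤ) (E : Finset (EuclideanSpace ℝ (Fin 3))),
        E ⊆ X \ P ∧ (E.card : ℝ) ≤ C * ρ ∧
        ∀ q ∈ (X \ P) \ E,
          (((X \ P).filter fun x => dist q x = 1 ∧ Φ x < Φ q).card : ℤ)
              + ((P.filter fun p => dist q p = 1).card : ℤ)
            ≤ (12 - ((X.filter fun x => dist q x = 1).card : ℤ))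
              + (((X \ P).filter fun x => dist q x = 1 ∧ Φ q < Φ x).card : ℤ)) := by
  rintro ⟨R, C, hR, h⟩
  refine ⟨R, C, hR, fun ν hν ρ hρ X P hX hPX hP => ?_⟩
  obtain ⟨E, hE, hEcard, hdeg⟩ := h ν hν ρ hρ X P hX hPX hP
  obtain ⟨Φ, hΦ⟩ := exists_potential_of_sixDegenerate X P ((X \ P) \ E) hPX sdiff_subset hdeg
  exact ⟨Φ, E, hE, hEcard, hΦ⟩

open scoped InnerProductSpace in
open Literature.MathematicalPhysics.StatisticalMechanics (fccStacking) in
/-- **`adhesion_of_certificate`** (R26 target typed by planner cf-p2, registered closed form;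
`PotentialCertificateExists →` the registered atom `stub_adhesion`): if around every `ν`-plug an
integer potential satisfies (T2) off a rim set of `≤ C ρ` balls, then the general-`ν` adhesion atom
holds with the linear rim defect `6 C ρ` (by `adhesion_of_potential`). -/
theorem adhesion_of_certificate :
    (∃ R C : ℝ, 1 ≤ R ∧ ∀ ν : EuclideanSpace ℝ (Fin 3), ‖ν‖ = 1 → ∀ ρ : ℝ, R ≤ ρ →
      ∀ X P : Finset (EuclideanSpace ℝ (Fin 3)),
      (∀ p ∈ X, ∀ q ∈ X, p ≠ q → 1 ≤ dist p q) → P ⊆ X →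
      (∀ p, p ∈ P ↔ (p ∈ fccStacking 1 (Real.sqrt (2 / 3)) ∧ -(2 * R) ≤ ⟪p, ν⟫_ℝ ∧
        ⟪p, ν⟫_ℝ ≤ -R ∧ ‖p‖ ^ 2 - ⟪p, ν⟫_ℝ ^ 2 ≤ ρ ^ 2)) →
      ∃ (Φ : EuclideanSpace ℝ (Fin 3) → ℤ) (E : Finset (EuclideanSpace ℝ (Fin 3))),
        E ⊆ X \ P ∧ (E.card : ℝ) ≤ C * ρ ∧
        ∀ q ∈ (X \ P) \ E,
          (((X \ P).filter fun x => dist q x = 1 ∧ Φ x < Φ q).card : ℤ)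
              + ((P.filter fun p => dist q p = 1).card : ℤ)
            ≤ (12 - ((X.filter fun x => dist q x = 1).card : ℤ))
              + (((X \ P).filter fun x => dist q x = 1 ∧ Φ q < Φ x).card : ℤ)) →
    (∃ R C : ℝ, 1 ≤ R ∧ ∀ ν : EuclideanSpace ℝ (Fin 3), ‖ν‖ = 1 → ∀ ρ : ℝ, R ≤ ρ →
      ∀ X P : Finset (EuclideanSpace ℝ (Fin 3)),
      (∀ p ∈ X, ∀ q ∈ X, p ≠ q → 1 ≤ dist p q) → P ⊆ X →
      (∀ p, p ∈ P ↔ (p ∈ fccStacking 1 (Real.sqrt (2 / 3)) ∧ -(2 * R) ≤ ⟪p, ν⟫_ℝ ∧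
        ⟪p, ν⟫_ℝ ≤ -R ∧ ‖p‖ ^ 2 - ⟪p, ν⟫_ℝ ^ 2 ≤ ρ ^ 2)) →
      ((((P ×ˢ (X \ P)).filter fun pq => dist pq.1 pq.2 = 1).card : ℕ) : ℝ) ≤
        contactDeficiency (X \ P) + C * ρ) := by
  rintro ⟨R, C, hR, h⟩
  refine ⟨R, 6 * C, hR, fun ν hν ρ hρ X P hX hPX hP => ?_⟩
  obtain ⟨Φ, E, hE, hEcard, hT2⟩ := h ν hν ρ hρ X P hX hPX hP
  have := cross_le_of_potential X P E hX hPX hE Φ hT2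
  have hρ0 : (0 : ℝ) ≤ ρ := le_trans (le_trans zero_le_one hR) hρ
  nlinarith [hEcard, this]

end Summit.Ventures.Crystal3D.Theorems
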